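import Literature.NumberTheory.GaloisRepresentations.GaloisCohomologyInfResProofs
import HarnessLib

/-!
# Restriction `H¹(K, M) → H¹(E, M)` on explicit cocycles

Generic glue for the `μ`-transfer core of BSD crux 19276 (HOME/koly/MU-TRANSFER-PROOF.md (F8):
"`h mod T = res κ̄' ≠ 0`"): the restriction map `galoisCohomology.res ρ E 1` sends the class of a
continuous crossed homomorphism `φ : Γ_K → M` to the class of `φ ∘ (Γ_E → Γ_K)`
(`res_oneCocycleClass`); hence, when `res` is injective (e.g. by Sah's lemma, tree
`galoisCohomology.res_one_injective_of_mem_center`), a cocycle with non-zero class takes a non-zero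
value on `Gal(K̄/E) = absGaloisFixingSubgroup E`
(`exists_mem_absGaloisFixingSubgroup_apply_ne_zero`).
-/

noncomputable section

open Function Field

universe u

namespace Literature.NumberTheory.GaloisRepresentations.galoisCohomology

variable {K : Type u} [Field K] {M : Type u} [AddCommGroup M] [TopologicalSpace M]
  [DiscreteTopology M] (ρ : DiscreteGaloisModule K M)

/-- **Restriction on cocycles**: `res [φ] = [φ ∘ (Γ_E → Γ_K)]` (Mathlib `ContinuousCohomology.map`
on explicit 1-cocycles, tree `map_oneCocycleClass`). [cite: SerreGaloisCohomology1997, I §2.4] -/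
theorem res_oneCocycleClass (E : Type u) [Field E] [Algebra K E]
    (φ : contOneCocycles ρ.toTopRep) :
    galoisCohomology.res ρ E 1 (oneCocycleClass ρ.toTopRep φ) =
      oneCocycleClass (DiscreteGaloisModule.toTopRep (ρ.restrictField E))
        (contOneCocycles.pullback (absGaloisRestrict K E)
          (TopRep.ofHom ⟨ContinuousLinearMap.id ℤ M, fun _ => rfl⟩ :
            TopRep.res (absGaloisRestrict K E : absoluteGaloisGroup E →* absoluteGaloisGroup K)
              ρ.toTopRep ⟶ DiscreteGaloisModule.toTopRep (ρ.restrictField E)) φ) :=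
  map_oneCocycleClass _ _ _ φ

/-- The value of the restricted cocycle: `(res φ)(σ) = φ(σ|_{K̄})`. [cite: SerreGaloisCohomology1997, I §2.4] -/
theorem pullback_absGaloisRestrict_apply (E : Type u) [Field E] [Algebra K E]
    (φ : contOneCocycles ρ.toTopRep) (σ : absoluteGaloisGroup E) :
    (contOneCocycles.pullback (absGaloisRestrict K E)
        (TopRep.ofHom ⟨ContinuousLinearMap.id ℤ M, fun _ => rfl⟩ :
          TopRep.res (absGaloisRestrict K E : absoluteGaloisGroup E →* absoluteGaloisGroup K)
            ρ.toTopRep ⟶ DiscreteGaloisModule.toTopRep (ρ.restrictField E)) φ).1 σ =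
      φ.1 (absGaloisRestrict K E σ) :=
  rfl

/-- **A cocycle with non-zero class is non-zero on `Gal(K̄/E)` when `res : H¹(K, M) → H¹(E, M)` is
injective** (for `E/K` a normal subextension of `K̄/K`; `Gal(K̄/E) = absGaloisFixingSubgroup E` is the
image of `Γ_E → Γ_K`, tree `range_absGaloisRestrict_eq_absGaloisFixingSubgroup`). With Sah's lemma
(`res_one_injective_of_mem_center`) this is (F8) of the `μ`-transfer memo: `res κ̄' ≠ 0`.
[cite: SerreGaloisCohomology1997, I §2.4] [cite: NeukirchSchmidtWingberg2008, (1.6.7)] -/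
theorem exists_mem_absGaloisFixingSubgroup_apply_ne_zero
    (E : IntermediateField K (AlgebraicClosure K)) [Normal K E]
    (hinj : Injective (galoisCohomology.res ρ E 1)) (φ : contOneCocycles ρ.toTopRep)
    (hφ : oneCocycleClass ρ.toTopRep φ ≠ 0) :
    ∃ τ ∈ absGaloisFixingSubgroup E, φ.1 τ ≠ 0 := by
  by_contra h
  push Not at h
  have h0 : galoisCohomology.res ρ E 1 (oneCocycleClass ρ.toTopRep φ) = 0 := by
    rw [res_oneCocycleClass]
    refine (oneCocycleClass_eq_zero_iff _ _).mpr ⟨0, fun σ => ?_⟩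
    rw [pullback_absGaloisRestrict_apply, map_zero, sub_zero]
    exact h _ (absGaloisRestrict_mem_absGaloisFixingSubgroup K E σ)
  exact hφ (hinj (h0.trans (map_zero _).symm))

end Literature.NumberTheory.GaloisRepresentations.galoisCohomology

end
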